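import Summits.RiemannHypothesis.RiemannHypothesis.Theorems.GroundBartaPolarPerronFrobeniusGapCertBridge
import HarnessLib

/-!
# Gap certificates from deflated Temple data, IIc: the two-prime certificate bridge, ODD sector
(route `RiemannHypothesis/GroundBarta`, crux `PolarPerronFrobenius` = stmt-RiemannHypothesis-18390 and its odd twin
W-POS-odd = stmt-RiemannHypothesis-17778, helper; RH-free, no definitions, no named facts, no sorry)

The odd-sector copy of `gc_even_gapShape_of_deflCert_wK` (`GroundBartaPolarPerronFrobeniusGapCertBridge`): the parity
ladder's weighted deflated Temple chain for ODD window tests (`dt_weilOddGroundEnergy_ge_of_deflCert_w`), with the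
rank-one penalty `K |Σ_l c_l ∫ φ v̄_l|²` carried through, the conclusion kept PER TEST, and the complement level scaled,
`n = (1 − θ)(β₂₃ − κ₂ 𝟙_E)`, so that any `λ ≤ θ (β₂₃ − κ₂)` is admissible with the `λ = 0`-type weights of an
odd-sector L-side cell divided by `1 − θ`.  Conclusion: `λ ∫|φ|² ≤ Re Q(φ) + K |Σ_l c_l ∫ φ v̄_l|²` for every odd
window test `φ` on `[-c, c]` — the deflation SHAPE that `PolarPerronFrobenius.gapCertificate_of_deflation` turns into an
odd gap certificate `H(φ, λ)` for `oddTwoLevelProximity_of_gapCertificate`.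

References: A. Weinstein, W. Stenger (1972) Ch. 5 §9; E. Bombieri, Rend. Mat. Acc. Lincei (9) 11 (2000) Thm 2, §4;
H. Yoshida, Adv. Stud. Pure Math. 21 (1992) Thm 1.  Prover B, speedrun unit `sr-gb-rung-b` (gen 17).
-/

set_option linter.dupNamespace false

noncomputable section

open MeasureTheory Set Filter
open scoped Topology ENNReal NNReal ComplexConjugate BigOperators

namespace Summit.RiemannHypothesis.RiemannHypothesis.Theorems.PolarPerronFrobenius

open Literature.NumberTheory.LFunctions Literature.NumberTheory.LFunctions.ConnesVanSuijlekom
open Summit.RiemannHypothesis.RiemannHypothesis.Theorems.EvenWinsBeyondArch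
open Summit.RiemannHypothesis.RiemannHypothesis.Theorems.OddSector (weilDirichletEnergy₂ weilPoleForm₂)

/-! ## The two-prime certificate bridge, odd sector, scaled complement level -/

/-- **Gap certificate in deflation shape from an odd-sector two-prime certificate** (odd twin of
`gc_even_gapShape_of_deflCert_wK`; copy of `dt_weilOddGroundEnergy_ge_of_deflCert_w`, conclusion per test, complement level scaled by `1 − θ`).  Window
`0 < c ≤ a₀`, `c ≤ (log 5)/2`; certificate `hcert23` at level `β₂₃` on the odd tests of `[-a₀, a₀]` with odd penalty data
`R` of non-negative weights; trial vectors `v_i = 𝟙_{[-c,c]} · maskPoly (R_i) n a₀` with explicit window images; any `W`;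
`κ₂ ≥ (log 2)/2` with `κ₂ < β₂₃`; `0 ≤ θ < 1` and `λ ≤ θ (β₂₃ − κ₂)`; edge threshold `y₁ ≤ log 4 − c`; a real `K`,
coefficients `c_l`; and the penalised weighted kernel datum `A − λG − R_w + K d dᵀ ⪰ 0` with
`w = 1/((1−θ)(β₂₃ − κ₂))` on `|y| ≥ y₁`, `1/((1−θ)β₂₃)` inside.  Then every odd window test `φ` on `[-c, c]` has
`λ ∫|φ|² ≤ Re Q(φ) + K |Σ_l c_l ∫ φ v̄_l|²`. [folklore] -/
theorem gc_odd_gapShape_of_deflCert_wK {c : ℝ} (hc : 0 < c) (hc5 : c ≤ Real.log 5 / 2)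
    {a₀ : ℝ} (hca : c ≤ a₀) (R : List (ℚ × ℕ × List ℚ)) (n : ℕ) {β₂₃ : ℝ}
    (hRodd : ∀ i : Fin R.length, (R.get i).2.1 % 2 = 1) (hRμ : ∀ i : Fin R.length, 0 ≤ (R.get i).1)
    (hcert23 : ∀ g : ℝ → ℂ, IsWeilTest g → tsupport g ⊆ Icc (-a₀) a₀ → (∀ x, g (-x) = -g x) →
      β₂₃ * weilNorm2Sq g ≤ weilTwoPrimeQuadratic g +
        (R.map fun r ↦ (r.1 : ℝ) * ‖∑ k ∈ Finset.range n, ((maskV r k : ℚ) : ℂ) * weilMoment a₀ g k‖ ^ 2).sum)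
    (v F : Fin R.length → ℝ → ℂ)
    (hv : ∀ i x, v i x = (((Icc (-c) c).indicator (fun x ↦ maskPoly (R.get i) n a₀ x) x : ℝ) : ℂ))
    (hF : ∀ i y, F i y = (Icc (-c) c).indicator (fun y ↦
        2 * (∫ x, v i x * (Real.cosh (x / 2) : ℂ)) * (Real.cosh (y / 2) : ℂ) -
          2 * (∫ x, v i x * (Real.sinh (x / 2) : ℂ)) * (Real.sinh (y / 2) : ℂ) +
        (∑ m ∈ weilPrimeIndex c, (((ArithmeticFunction.vonMangoldt m : ℝ) / Real.sqrt m : ℝ) : ℂ) *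
          (2 * v i y - v i (y - Real.log m) - v i (y + Real.log m))) +
        ∫ t in Ioi 0, (weilArchDensity t : ℂ) * (2 * v i y - v i (y - t) - v i (y + t))) y -
      (weilMarkovConstant c : ℂ) * v i y)
    (W : Fin R.length → Fin R.length → ℝ) {κ₂ : ℝ} (hκ : Real.log 2 / 2 ≤ κ₂) (hκβ : κ₂ < β₂₃)
    {θ : ℝ} (hθ : 0 ≤ θ) (hθ1 : θ < 1) {lam : ℝ} (hlam : lam ≤ θ * (β₂₃ - κ₂))
    {y₁ : ℝ} (hy : y₁ ≤ Real.log 4 - c) (K : ℝ) (cv : Fin R.length → ℝ)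
    (hPSD : ∀ α : Fin R.length → ℝ, 0 ≤ ∑ i, ∑ j, α i * α j *
      ((weilPoleForm₂ (v i) (v j) + weilDirichletEnergy₂ c (v i) (v j) -
          weilMarkovConstant c * ∫ x, (v i x * conj (v j x)).re) - lam * (∫ x, (v i x * conj (v j x)).re) -
        (∫ y, {u : ℝ | y₁ ≤ |u|}.piecewise (fun _ ↦ 1 / ((1 - θ) * (β₂₃ - κ₂))) (fun _ ↦ 1 / ((1 - θ) * β₂₃)) y *
          ((F i - ∑ l, W i l • v l) y * conj ((F j - ∑ l, W j l • v l) y)).re) +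
        K * ((∑ l, cv l * ∫ x, (v l x * conj (v i x)).re) * (∑ l, cv l * ∫ x, (v l x * conj (v j x)).re))))
    {φ : ℝ → ℂ} (hφ : IsWeilTest φ) (hφs : tsupport φ ⊆ Icc (-c) c) (hφo : ∀ x, φ (-x) = -φ x) :
    lam * ∫ x, ‖φ x‖ ^ 2 ≤ (weilQuadratic φ).re + K * ‖∑ l, (cv l : ℂ) * ∫ x, φ x * conj (v l x)‖ ^ 2 := by
  -- adapted from EvenWinsBeyondArch.dt_weilOddGroundEnergy_ge_of_deflCert_w (complement level scaled by 1 − θ)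
  have hE : MeasurableSet {u : ℝ | y₁ ≤ |u|} := measurableSet_le measurable_const continuous_abs.measurable
  set nE : ℝ := (1 - θ) * (β₂₃ - κ₂) with hnE
  set nI : ℝ := (1 - θ) * β₂₃ with hnI
  have h1θ : 0 < 1 - θ := by linarith
  have hlog : 0 ≤ Real.log 2 / 2 := by positivity
  have hκ0 : 0 ≤ κ₂ := hlog.trans hκ
  have hnE0 : 0 < nE := by rw [hnE]; exact mul_pos h1θ (by linarith)
  have hnI0 : 0 < nI := by rw [hnI]; exact mul_pos h1θ (by linarith)
  have hnEI : nE ≤ nI := by rw [hnE, hnI]; nlinarith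
  set C : ℝ := nI + 1 / nE with hC
  have hpw : ∀ (a b : ℝ) (y : ℝ), {u : ℝ | y₁ ≤ |u|}.piecewise (fun _ ↦ a) (fun _ ↦ b) y = a ∨
      {u : ℝ | y₁ ≤ |u|}.piecewise (fun _ ↦ a) (fun _ ↦ b) y = b := by
    intro a b y
    by_cases hy' : y ∈ {u : ℝ | y₁ ≤ |u|}
    · exact Or.inl (Set.piecewise_eq_of_mem _ _ _ hy')
    · exact Or.inr (Set.piecewise_eq_of_notMem _ _ _ hy')
  have hmeas : ∀ a b : ℝ, Measurable ({u : ℝ | y₁ ≤ |u|}.piecewise (fun _ ↦ a) (fun _ ↦ b)) := fun a b ↦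
    Measurable.piecewise hE measurable_const measurable_const
  refine gc_sector_bound_of_ritz_wK hc (-1) (fun i x ↦ maskPoly (R.get i) n a₀ x)
    (fun i ↦ contDiff_maskPoly (R.get i) n a₀) (fun i x ↦ by
      rw [maskPoly_neg_of_odd (R.get i) (hRodd i) n a₀ x]; ring)
    v F hv hF W (fun i ↦ ((R.get i).1 : ℝ)) lam (fun i ↦ by exact_mod_cast hRμ i) K cv
    (n := {u : ℝ | y₁ ≤ |u|}.piecewise (fun _ ↦ nE) (fun _ ↦ nI))
    (w := {u : ℝ | y₁ ≤ |u|}.piecewise (fun _ ↦ 1 / nE) (fun _ ↦ 1 / nI)) (C := C)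
    (hmeas _ _) (hmeas _ _) ?_ ?_ ?_ ?_ ?_ ?_ hPSD hφ hφs (fun x ↦ by simpa using hφo x)
  · intro y
    have h1 : 0 ≤ 1 / nE := by positivity
    rcases hpw nE nI y with h | h <;> rw [h]
    · rw [abs_of_pos hnE0, hC]; linarith
    · rw [abs_of_pos hnI0, hC]; linarith
  · intro y
    have h1 : 1 / nI ≤ 1 / nE := one_div_le_one_div_of_le hnE0 hnEI
    rcases hpw (1 / nE) (1 / nI) y with h | h <;> rw [h]
    · rw [abs_of_pos (by positivity), hC]; linarith [hnI0.le]
    · rw [abs_of_pos (by positivity), hC]; linarith [hnI0.le]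
  · intro y; rcases hpw nE nI y with h | h <;> rw [h] <;> positivity
  · intro y; rcases hpw (1 / nE) (1 / nI) y with h | h <;> rw [h] <;> positivity
  · intro y
    by_cases hy' : y ∈ {u : ℝ | y₁ ≤ |u|}
    · rw [Set.piecewise_eq_of_mem _ _ _ hy', Set.piecewise_eq_of_mem _ _ _ hy']; field_simp
    · rw [Set.piecewise_eq_of_notMem _ _ _ hy', Set.piecewise_eq_of_notMem _ _ _ hy']; field_simp
  · -- the scaled weighted certificate on smooth odd tests
    intro ψ hψ hψs hψp
    have hψo : ∀ x, ψ (-x) = -ψ x := fun x ↦ by simpa using hψp x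
    have hψa : tsupport ψ ⊆ Icc (-a₀) a₀ := hψs.trans (Icc_subset_Icc (by linarith) hca)
    have h23 := hcert23 ψ hψ hψa hψo
    have hsl := dt_weilTwoPrimeQuadratic_sub_edge_le_weilQuadratic_re hψ hψs hc5 hy
    have hsum : (R.map fun r ↦ (r.1 : ℝ) * ‖∑ k ∈ Finset.range n, ((maskV r k : ℚ) : ℂ) * weilMoment a₀ ψ k‖ ^ 2).sum =
        ∑ i : Fin R.length, ((R.get i).1 : ℝ) * ‖∫ x, ψ x * conj (v i x)‖ ^ 2 := by
      rw [dt_list_sum_map_eq_sum_get]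
      refine Finset.sum_congr rfl fun i _ ↦ ?_
      rw [dt_rankOne_term_eq (R.get i) n a₀ hψ hψs]
      simp only [hv i]
    have hnorm : weilNorm2Sq ψ = ∫ x, ‖ψ x‖ ^ 2 := rfl
    have h2 : Integrable fun u : ℝ ↦ ‖ψ u‖ ^ 2 := hψ.integrable_norm_sq
    have hn_int : (∫ y, {u : ℝ | y₁ ≤ |u|}.piecewise (fun _ ↦ nE) (fun _ ↦ nI) y * ‖ψ y‖ ^ 2) =
        nI * (∫ y, ‖ψ y‖ ^ 2) + (nE - nI) * ∫ y, {u : ℝ | y₁ ≤ |u|}.indicator (fun u ↦ ‖ψ u‖ ^ 2) y :=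
      dt_integral_piecewise_mul hE nE nI h2
    have hEI : nE - nI = -((1 - θ) * κ₂) := by rw [hnE, hnI]; ring
    rw [hsum, hnorm] at h23
    rw [hn_int, hEI, hnI]
    -- `0 ≤ X ≤ ∫|ψ|²` for the edge mass `X`
    set X : ℝ := ∫ y, {u : ℝ | y₁ ≤ |u|}.indicator (fun u ↦ ‖ψ u‖ ^ 2) y with hX
    set N2 : ℝ := ∫ y, ‖ψ y‖ ^ 2 with hN2
    have hX0 : 0 ≤ X := integral_nonneg fun y ↦ Set.indicator_nonneg (fun _ _ ↦ by positivity) y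
    have hXN : X ≤ N2 := by
      refine integral_mono (h2.indicator hE) h2 fun y ↦ ?_
      exact Set.indicator_le_self' (fun _ _ ↦ by positivity) y
    have hN0 : 0 ≤ N2 := integral_nonneg fun y ↦ by positivity
    have hκX := mul_le_mul_of_nonneg_right hκ hX0
    -- `λ N2 ≤ θ β₂₃ N2 − θ κ₂ X`
    have hlamN : lam * N2 ≤ θ * (β₂₃ - κ₂) * N2 := mul_le_mul_of_nonneg_right hlam hN0
    have hθκ : θ * κ₂ * X ≤ θ * κ₂ * N2 := mul_le_mul_of_nonneg_left hXN (mul_nonneg hθ hκ0)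
    nlinarith [h23, hsl, hκX, hlamN, hθκ, hX0, hN0, hθ, hκ0]

end Summit.RiemannHypothesis.RiemannHypothesis.Theorems.PolarPerronFrobenius

end
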